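import Summits.Ventures.PercRepro.C026MarkCEdge

/-!
# The mark–`c` step of the `κ`-induction (p6, gen 15; mine-3 INBOX 04:29Z (1))

For the `κ`-slack `s_κ = P(B ∧ Aᶜ) − κ·P(B)·P(Aᶜ)` (`slackGamma κ`) and an edge `e` joining `c` to a mark,
`s_κ(H − e) ≥ 0` alone gives SA with the constant `1/κ` for `s_κ` at `e` whenever `0 < κ ≤ ¾`
(`SAGamma26_of_markC`), so by `slackGamma_nonneg_of_saGamma` the `κ`-slack propagates through every
mark–`c` edge: with the notation of Theorem A (`C026MarkCEdge`), `s_κ(H / e) = (1 − κ)(α − Y)`,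
`s_κ(H − e) = W − κ(1 − M) α` with `W ≥ Y`, and the claim `κ M Y ≤ s_κ(H − e) + s_κ(H / e)` reduces to
`κ²(1 − M)² + κ M − 2κ + 1 = (κ(1 − M) − ½)² + (¾ − κ) ≥ 0`.  The threshold `¾` is sharp for this
argument (the 3-star at `M = 1 − 1/(2κ)`).
-/

namespace PercRepro

open Finset

namespace MultiGraph

variable {V E : Type*} (G : MultiGraph V E) [Fintype E] [DecidableEq E]

/-! ### The `κ`-step at mark–`c` edges (mine-3 INBOX 04:29Z (1)) -/

/-- The `γ`-slack at `p[e:=1]` as probabilities of the open lifts. -/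
theorem slackGamma_update_one_eq_lift (γ : ℝ) (p : E → ℝ) (e : E) (a b c : V) :
    G.slackGamma γ (Function.update p e 1) a b c =
      prob p (lift e true (G.connEvent c a ∪ G.connEvent c b) ∩ (lift e true (G.connEvent a b))ᶜ) -
        γ * (prob p (lift e true (G.connEvent c a ∪ G.connEvent c b)) *
          prob p (lift e true (G.connEvent a b))ᶜ) := by
  rw [slackGamma_eq_prob, prob_update_one_eq_prob_lift, prob_update_one_eq_prob_lift,
    prob_update_one_eq_prob_lift]
  rfl

/-- The `γ`-slack at `p[e:=0]` as probabilities of the closed lifts. -/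
theorem slackGamma_update_zero_eq_lift (γ : ℝ) (p : E → ℝ) (e : E) (a b c : V) :
    G.slackGamma γ (Function.update p e 0) a b c =
      prob p (lift e false (G.connEvent c a ∪ G.connEvent c b) ∩ (lift e false (G.connEvent a b))ᶜ) -
        γ * (prob p (lift e false (G.connEvent c a ∪ G.connEvent c b)) *
          prob p (lift e false (G.connEvent a b))ᶜ) := by
  rw [slackGamma_eq_prob, prob_update_zero_eq_prob_lift, prob_update_zero_eq_prob_lift,
    prob_update_zero_eq_prob_lift]
  rfl

/-- **The mark–`c` step of the `κ`-induction** (mine-3, INBOX 04:29Z (1)): for `0 < κ ≤ ¾`, if the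
`κ`-slack of `H − e` is nonnegative then SA with the constant `1/κ` for `s_κ` holds at every edge
joining `c` to the mark `a` — so `s_κ(H) ≥ 0` follows (`slackGamma_nonneg_of_saGamma`).  With the
notation of Theorem A: `s_κ(H/e) = (1 − κ)(α − Y)`, `s_κ(H − e) = W − κ(1 − M) α ≥ 0` with `W ≥ Y`,
and the claim `κ M Y ≤ s_κ(H − e) + s_κ(H/e)` reduces to
`κ²(1 − M)² + κ M − 2κ + 1 = (κ(1 − M) − ½)² + (¾ − κ) ≥ 0`. -/
theorem SAGamma26_of_edge_ca {κ : ℝ} (hκ0 : 0 < κ) (hκ : κ ≤ 3 / 4) {p : E → ℝ} (hp : IsProb p)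
    {e : E} {a c : V} (he : (G.fst e = a ∧ G.snd e = c) ∨ (G.fst e = c ∧ G.snd e = a)) (b : V)
    (h0 : 0 ≤ G.slackGamma κ (Function.update p e 0) a b c) :
    G.SAGamma26 κ (1 / κ) p e a b c := by
  unfold SAGamma26
  have hBt := G.lift_true_B_eq_univ he b
  have hAt := G.lift_true_A_eq he b
  have hD : G.pivD26 p e a b c = 1 - prob p (lift e false (G.connEvent c a ∪ G.connEvent c b)) := by
    rw [pivD26_eq_rowsB, G.law3_zero_add_two_add_three, G.law3_zero_add_two_add_three,
      prob_update_one_eq_prob_lift, prob_update_zero_eq_prob_lift, hBt, prob_univ]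
  have hsplit := prob_inter_add_prob_inter_compl p (lift e false (G.connEvent a b))ᶜ
    (lift e false (G.connEvent c b))
  have hA : G.pivA26 p e a b c =
      prob p ((lift e false (G.connEvent a b))ᶜ ∩ lift e false (G.connEvent c b)) := by
    rw [pivA26_eq_rowsAc, G.law3_two_add_three_add_four, G.law3_two_add_three_add_four,
      prob_update_one_eq_prob_lift, prob_update_zero_eq_prob_lift]
    change prob p (lift e false (G.connEvent a b))ᶜ - prob p (lift e true (G.connEvent a b))ᶜ = _
    rw [hAt, Set.compl_union]
    linarith
  have hs1 : G.slackGamma κ (Function.update p e 1) a b c =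
      (1 - κ) * (prob p (lift e false (G.connEvent a b))ᶜ -
        prob p ((lift e false (G.connEvent a b))ᶜ ∩ lift e false (G.connEvent c b))) := by
    rw [slackGamma_update_one_eq_lift, hBt, hAt, Set.univ_inter, prob_univ, Set.compl_union, one_mul]
    linear_combination (1 - κ) * hsplit
  have hs0 := G.slackGamma_update_zero_eq_lift κ p e a b c
  rw [hs0] at h0 ⊢
  rw [hD, hA, hs1]
  have hsub : (lift e false (G.connEvent a b))ᶜ ∩ lift e false (G.connEvent c b) ⊆
      lift e false (G.connEvent c a ∪ G.connEvent c b) ∩ (lift e false (G.connEvent a b))ᶜ := by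
    rintro ω ⟨h1, h2⟩
    exact ⟨Or.inr h2, h1⟩
  have hYW := prob_mono hp hsub
  have hα0 : 0 ≤ prob p (lift e false (G.connEvent a b))ᶜ := prob_nonneg hp _
  have hY0 : 0 ≤ prob p ((lift e false (G.connEvent a b))ᶜ ∩ lift e false (G.connEvent c b)) :=
    prob_nonneg hp _
  have hBf0 : 0 ≤ prob p (lift e false (G.connEvent c a ∪ G.connEvent c b)) := prob_nonneg hp _
  have hBf1 : prob p (lift e false (G.connEvent c a ∪ G.connEvent c b)) ≤ 1 := prob_le_one hp _
  set M := 1 - prob p (lift e false (G.connEvent c a ∪ G.connEvent c b)) with hM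
  set Y := prob p ((lift e false (G.connEvent a b))ᶜ ∩ lift e false (G.connEvent c b)) with hY
  set α := prob p (lift e false (G.connEvent a b))ᶜ with hα
  set W := prob p (lift e false (G.connEvent c a ∪ G.connEvent c b) ∩
    (lift e false (G.connEvent a b))ᶜ) with hWdef
  have hM0 : 0 ≤ M := by rw [hM]; linarith
  have hM1 : M ≤ 1 := by rw [hM]; linarith
  have hW : κ * ((1 - M) * α) ≤ W := by rw [hM]; linarith
  have h1 : 0 ≤ 1 - κ * (1 - M) := by nlinarith
  have hκ1M : 0 ≤ κ * (1 - M) := mul_nonneg hκ0.le (by linarith)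
  rw [div_mul_eq_mul_div, le_div_iff₀ hκ0]
  nlinarith [mul_le_mul_of_nonneg_left hYW h1, mul_le_mul_of_nonneg_left hW hκ1M,
    mul_nonneg hα0 (sq_nonneg (κ * (1 - M) - 1 / 2)), mul_nonneg hα0 (sub_nonneg.2 hκ)]

/-- The `γ`-slack is symmetric in the marks `a`, `b`. -/
theorem slackGamma_swap (γ : ℝ) (p : E → ℝ) (a b c : V) :
    G.slackGamma γ p a b c = G.slackGamma γ p b a c := by
  have hs : G.sepEvent a b = G.sepEvent b a := by
    unfold sepEvent
    rw [G.connEvent_comm a b]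
  rw [slackGamma_eq_prob, slackGamma_eq_prob, Set.union_comm, hs]

/-- SA for the `γ`-slack at `e` is symmetric in the marks `a`, `b`. -/
theorem SAGamma26_swap (γ κ : ℝ) (p : E → ℝ) (e : E) (a b c : V) :
    G.SAGamma26 γ κ p e a b c ↔ G.SAGamma26 γ κ p e b a c := by
  unfold SAGamma26
  rw [G.slackGamma_swap _ _ a b c, G.slackGamma_swap _ _ a b c, G.pivD26_swap_ab, G.pivA26_swap_ab]

/-- **The mark–`c` step at every mark–`c` edge**: for `0 < κ ≤ ¾` and `s_κ(H − e) ≥ 0`, SA with the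
constant `1/κ` for `s_κ` holds at every edge joining `c` to `a` or to `b`. -/
theorem SAGamma26_of_markC {κ : ℝ} (hκ0 : 0 < κ) (hκ : κ ≤ 3 / 4) {p : E → ℝ} (hp : IsProb p)
    {e : E} {a b c : V}
    (he : ((G.fst e = a ∧ G.snd e = c) ∨ (G.fst e = c ∧ G.snd e = a)) ∨
      ((G.fst e = b ∧ G.snd e = c) ∨ (G.fst e = c ∧ G.snd e = b)))
    (h0 : 0 ≤ G.slackGamma κ (Function.update p e 0) a b c) :
    G.SAGamma26 κ (1 / κ) p e a b c := by
  rcases he with he | he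
  · exact G.SAGamma26_of_edge_ca hκ0 hκ hp he b h0
  · rw [G.SAGamma26_swap]
    rw [G.slackGamma_swap] at h0
    exact G.SAGamma26_of_edge_ca hκ0 hκ hp he a h0

/-! ### The `κ`-induction with an edge CHOSEN per instance (mine-3 §8 (a)) -/

/-- **The `κ`-induction with a chosen edge**: if every instance with a fractional edge has SOME
fractional edge at which SA with the constant `κ'` for `s_γ` holds, then `s_γ ≥ 0` everywhere
(`0 ≤ γ ≤ 1`, `0 ≤ κ'`, `γ κ' ≤ 1`).  The hypothesis is quantified over all weight vectors of the
graph, so the minors' instances are covered; mine-3's program takes the edge at `c` (a mark–`c` edge by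
`SAGamma26_of_markC`, a `c`–non-mark edge by (CE_κ)). -/
theorem slackGamma_nonneg_of_exists_saGamma {γ κ' : ℝ} (hγ0 : 0 ≤ γ) (hγ1 : γ ≤ 1) (hκ0 : 0 ≤ κ')
    (hγκ : γ * κ' ≤ 1) (a b c : V)
    (hSA : ∀ p : E → ℝ, IsProb p → (fracEdges p).Nonempty →
      ∃ e ∈ fracEdges p, G.SAGamma26 γ κ' p e a b c) :
    ∀ p : E → ℝ, IsProb p → 0 ≤ G.slackGamma γ p a b c := by
  suffices H : ∀ n : ℕ, ∀ p : E → ℝ, IsProb p → (fracEdges p).card = n →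
      0 ≤ G.slackGamma γ p a b c by
    intro p hp
    exact H _ p hp rfl
  intro n
  refine Nat.strong_induction_on n ?_
  intro n ih p hp hn
  by_cases hlive : fracEdges p = ∅
  · exact G.slackGamma_nonneg_of_zeroOne hγ1 (isZeroOne_of_fracEdges_eq_empty hlive) a b c
  · obtain ⟨e, he, hsa⟩ := hSA p hp (Finset.nonempty_iff_ne_empty.2 hlive)
    have h0 : 0 ≤ G.slackGamma γ (Function.update p e 0) a b c :=
      ih _ (hn ▸ card_fracEdges_update_lt he (Or.inl rfl)) _
        (hp.update e ⟨le_rfl, zero_le_one⟩) rfl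
    have h1 : 0 ≤ G.slackGamma γ (Function.update p e 1) a b c :=
      ih _ (hn ▸ card_fracEdges_update_lt he (Or.inr rfl)) _
        (hp.update e ⟨zero_le_one, le_rfl⟩) rfl
    exact G.slackGamma_nonneg_of_saGamma hγ0 hκ0 hγκ hp hsa h0 h1

/-- **The mark–`c` edges are free for `κ ≤ ¾`**: in the chosen-edge induction, an instance whose chosen
fractional edge joins `c` to a mark needs nothing but the deletion minor. -/
theorem saGamma_markC_of_slackGamma_minor {κ : ℝ} (hκ0 : 0 < κ) (hκ : κ ≤ 3 / 4) {p : E → ℝ}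
    (hp : IsProb p) {e : E} {a b c : V}
    (he : ((G.fst e = a ∧ G.snd e = c) ∨ (G.fst e = c ∧ G.snd e = a)) ∨
      ((G.fst e = b ∧ G.snd e = c) ∨ (G.fst e = c ∧ G.snd e = b)))
    (h0 : 0 ≤ G.slackGamma κ (Function.update p e 0) a b c) :
    G.SAGamma26 κ (1 / κ) p e a b c :=
  G.SAGamma26_of_markC hκ0 hκ hp he h0

end MultiGraph

end PercRepro
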